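import Summits.BirchSwinnertonDyer.BirchSwinnertonDyer.Theorems.ByReductionTypeAtTwoSupersingularFlatLocalDualityMap
import Literature.NumberTheory.EllipticCurves.Sprung2012.SharpFlatSelmerDualInvolutionTwistProofs
import HarnessLib

/-!
# Route `ByReductionTypeAtTwo` (rung K4), crux `SupersingularRankZeroAtTwo` (item stmt-BirchSwinnertonDyer-19097), line
# `odd_blind_package`, stub `stub_flatPackage`, conjunct (8), clause F1♭ — **THE ♭ LOCAL DUALITY MAP IS `Λ`-LINEAR INTO A
# CONTRAGREDIENT PIN: `ν : H¹_Iw(K_v, T) →ₗ[Λ] X♭` for a pin of key `δ = γ⁻¹`** (any number field `K`, prime `p`, `ℤ_p`-extension,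
# place `v`, generator pair `(γ, g)`; cell `bsd-2adic`, seat `bsd-2adic-tower-1` GEN 67, hand H2-F1F3; the linear twin of
# `…FlatLocalDualityMap` (p830536) asked by the pen's RC-800 (R1); `--supports 19097`, helper)

HONEST FRAMING (D-0054): THEOREMS ONLY — no definition, no named fact, no instance, no `sorry`.

`…FlatLocalDualityMap` (p830536) builds the print map `ν : w ↦ [s ↦ Φ(res_v s)(w)]` from `H¹_Iw(K_v,T)` (functionals `E(K_∞·K_v) →+ ℤ_p`)
to a pinned `X♭ = Hom(Sel♭(E/K_∞), ℚ/ℤ)` and shows that for a pin of the SAME key `γ` that is sent to `1 + T` on the functionals it is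
`ι`-SEMILINEAR.  The Kummer pairing being contragredient, the LINEAR version lives on a pin of the INVERSE key: for `γ δ = 1` and
`D : SharpFlatSelmerDualData W κ δ …` (`(T·x)(s) = x(conj_δ s) − x(s)`), `ν` is an honest `Λ`-LINEAR map — the repair (R1) «contragredient
keying» of the convention finding `HOME/tower/gen67/F3-ERL-flat-at-2.md` §4 recommended by the pen (RC-800 (B)): in (8) only the dual data
`D`, `Y` are re-keyed to `γ⁻¹`; `I`, `loc` and all three maps stay `Λ`-linear.  FULL `Λ`-linearity is proved: through `toDual` the action
of ANY pin is the finite-sum action (`SharpFlatSelmerDualData.toDual_smul`, `IwasawaDual.evalT`: `(f·x)(s) = Σ_{i<N} c_i x(ψ^i s)`,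
`ψ = conj_δ − 1`, `ψ^N s = 0`, `p^k s = 0`); the bridge is the ONE identity `Φ(s)((1+T)·w) = Φ(conj_δ s)(w)` (Kummer data of a conjugate
class, `conj_γ ∘ conj_δ = id`), iterated to `Φ(ψ^i s)(w) = Φ(s)(T^i·w)`, plus `Φ(s)(C a·w) = (a mod p^k)·Φ(s)(w)` and the vanishing of the
tail `T^N·q` on `s`.

What is proved: `exists_flatLocalDualityHom_of_key` (the key-free additive `ν` with (V) values, (K) `Ker Col♭ ⊆ ker ν`, (Z) `ν w` kills
`Sel₀`, any key); `toDual_flatLocalDualityHom_conjH1_of_mul_eq_one` (the bridge); `toDual_flatLocalDualityHom_C_smul` (constants);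
`flatLocalDualityHom_map_smul_of_mul_eq_one` (ANY additive map with the Kummer values is `Λ`-linear into a pin of key `δ`); ★
`exists_flatLocalDualityLinearMap_of_mul_eq_one` (`∃ ν : (E(K_∞·K_v) →+ ℤ_p) →ₗ[Λ] D.X` with (V) (K) (Z)).  The descent
`toX : Λ →ₗ[Λ] D.X` along a `Λ`-linear ♭ Coleman map onto `Λ` is the sequel `…FlatToXLinear`.  `Function.Exact loc toX` / `Exact toX δ`
(Poitou–Tate) are NOT claimed.  Closes NO stub; 19097 OPEN; nothing booked; BSD is proved for no curve; typed ≠ proved.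

References: [Kobayashi2003] (7.17)–(7.21) (p. 12), §2 p. 4; [Sprung2012] §2 p. 1486 (`γ ↦ 1+T`), Def. 7.9, 7.11 (p. 1503), Prop. 7.19
(p. 1505); [GreenbergLNM1716] §1 p. 60; [Greenberg1989] pp. 101–102 (`S^ι`); [KitajimaOtsuki2018] (4.2), Prop. 3.32; [Washington1997] §13.2.
-/

set_option autoImplicit false
-- the Theorems namespace of this sub repeats the summit name by design (D-0017 nested layout)
set_option linter.dupNamespace false

noncomputable section

open scoped Classical NumberField

universe u

namespace Summit.BirchSwinnertonDyer.BirchSwinnertonDyer.Theorems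

namespace SSFlatPackage

open NumberField IsDedekindDomain Field WeierstrassCurve Literature.NumberTheory.EllipticCurves
  Literature.NumberTheory.EllipticCurves.Sprung2012 Literature.NumberTheory.EllipticCurves.Sprung2017
  Literature.NumberTheory.EllipticCurves.Kobayashi2003 Literature.NumberTheory.EllipticCurves.IwasawaDual
  Literature.NumberTheory.EllipticCurves.GreenbergSelmer Literature.NumberTheory.GaloisRepresentations
  Literature.Algebra.Module ZpExtension

/-- **Scalars act on pairing characters through `ℤ/p^k`**: `e x k (a • z) = (a mod p^k) • e x k z` (`(a·z)(x)/p^k = a·(z(x)/p^k)`).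
[cite: NeukirchSchmidtWingberg2008, I §1 (1.1.8)] -/
private theorem padicPairingFamily_smul_right {N : Type*} [AddCommGroup N] {p : ℕ} [Fact p.Prime]
    {e : N → ℕ → ((N →+ ℤ_[p]) →+ AddCircle (1 : ℚ))}
    (he : ∀ (x : N) (k : ℕ) (z : N →+ ℤ_[p]) (a : ℤ), PadicInt.toZModPow k (z x) = (a : ZMod (p ^ k)) →
      e x k z = (((a : ℚ) / (p : ℚ) ^ k : ℚ) : AddCircle (1 : ℚ)))
    (x : N) (k : ℕ) (a : ℤ_[p]) (z : N →+ ℤ_[p]) :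
    e x k (a • z) = zpT p k a (e x k z) := by
  haveI : NeZero (p ^ k) := ⟨pow_ne_zero _ (Fact.out : p.Prime).ne_zero⟩
  obtain ⟨b, hb⟩ := ZMod.intCast_surjective (PadicInt.toZModPow k (z x))
  have hab : PadicInt.toZModPow k ((a • z) x) = ((((PadicInt.toZModPow k a).val : ℤ) * b : ℤ) : ZMod (p ^ k)) := by
    rw [AddMonoidHom.smul_apply, smul_eq_mul, map_mul, ← hb, Int.cast_mul, Int.cast_natCast, ZMod.natCast_zmod_val]
  rw [he x k z b hb.symm, he x k (a • z) _ hab, zpT_def, ← AddCircle.coe_nsmul]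
  congr 1
  push_cast
  rw [nsmul_eq_mul, mul_div_assoc]

variable {K : Type u} [Field K] [NumberField K] (W : WeierstrassCurve K) {p : ℕ} [hp : Fact p.Prime]
  (κ : ZpExtension K p) {γ : absoluteGaloisGroup K} (v : HeightOneSpectrum (𝓞 K)) {ap : ℤ}
  {g : absoluteGaloisGroup (v.adicCompletion K)} {c : ℕ → localPoints W (v.adicCompletion K)}

/-- **The ♭ local duality map for a pin of ANY key** (the key-free part of `exists_flatLocalDualityHom`, p830536): for `p ∣ a_p`,
data `c`, any ♭ Coleman family `J` (`Col(z) = (Js z, (J z).2)`) and any ♭ dual datum `D` of any key `γ_D`, there is an ADDITIVE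
`ν : (E(K_∞·K_v) →+ ℤ_p) →+ D.X`, `ν w = toDual⁻¹ [s ↦ Φ(res_v s)(w)]`, with (V) `D.toDual (ν w) s = w(p^kQ)/p^k mod ℤ` for every Kummer
datum `(φ, Q, k)` of `s ∈ Sel♭` at `v`; (K) `(J w).2 = 0 → ν w = 0` (`Ker Col♭ ⊆ ker ν`); (Z) `ν w` kills `Sel₀(K_∞, E[p^∞])`.
[cite: Kobayashi2003, (7.17)–(7.21) (p. 12) and §2 p. 4] [cite: Sprung2012, Def. 7.9, Def. 7.11 (p. 1503), Prop. 7.19 (p. 1505)]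
[cite: GreenbergLNM1716, §1 p. 60 and §4 (8) p. 121] [cite: KitajimaOtsuki2018, (4.2) and Prop. 3.32] -/
theorem exists_flatLocalDualityHom_of_key (hap : (p : ℤ) ∣ ap)
    {M : Type*} (J : (localTowerPointsOfEmb κ (closureEmb (K := K) (v.adicCompletion K)) W →+ ℤ_[p]) → M × IwasawaAlgebra p)
    {Js : (localTowerPointsOfEmb κ (closureEmb (K := K) (v.adicCompletion K)) W →+ ℤ_[p]) → IwasawaAlgebra p}
    (hJ : ∀ z, IsColemanPair κ (closureEmb (K := K) (v.adicCompletion K)) W ap g c z (Js z) (J z).2)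
    {γD : absoluteGaloisGroup K} (D : SharpFlatSelmerDualData W κ γD (closureEmb (K := K) (v.adicCompletion K)) ap g c .flat) :
    ∃ ν : (localTowerPointsOfEmb κ (closureEmb (K := K) (v.adicCompletion K)) W →+ ℤ_[p]) →+ D.X,
      (∀ (w : localTowerPointsOfEmb κ (closureEmb (K := K) (v.adicCompletion K)) W →+ ℤ_[p])
          (s : sharpFlatSelmerInfty W κ (closureEmb (K := K) (v.adicCompletion K)) ap g c .flat)
          (φ : contOneCocycles.{0, u} (discreteTopRep κ.kerSubgroup (W.geomPrimaryTorsion p)))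
          (Q : localPoints W (v.adicCompletion K)) (k : ℕ)
          (hQ : (p ^ k) • Q ∈ localTowerPointsOfEmb κ (closureEmb (K := K) (v.adicCompletion K)) W),
          oneCocycleClass (discreteTopRep κ.kerSubgroup (W.geomPrimaryTorsion p)) φ = (s : W.subgroupH1 p κ.kerSubgroup) →
          (∀ τ : localSubgroupOfEmb κ.kerSubgroup (closureEmb (K := K) (v.adicCompletion K)),
            pointsMapOfEmb W (closureEmb (K := K) (v.adicCompletion K))
                ((φ.1 (resGalSubgroupOfEmb κ.kerSubgroup _ τ) : W.geomPrimaryTorsion p) : W.geomPoints) =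
              (τ : absoluteGaloisGroup (v.adicCompletion K)) • Q - Q) →
          ∀ a : ℤ, PadicInt.toZModPow k (w ⟨(p ^ k) • Q, hQ⟩) = (a : ZMod (p ^ k)) →
            D.toDual (ν w) s = (((a : ℚ) / (p : ℚ) ^ k : ℚ) : AddCircle (1 : ℚ))) ∧
      (∀ w, (J w).2 = 0 → ν w = 0) ∧
      (∀ (w) (s : sharpFlatSelmerInfty W κ (closureEmb (K := K) (v.adicCompletion K)) ap g c .flat),
          (s : W.subgroupH1 p κ.kerSubgroup) ∈ W.fineSelmerInfty κ → D.toDual (ν w) s = 0) := by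
  obtain ⟨e, he⟩ := exists_padicPairingFamily
    (N := localTowerPointsOfEmb κ (closureEmb (K := K) (v.adicCompletion K)) W) (p := p)
  obtain ⟨Φ, hΦ⟩ := OddBlindNF.exists_kummerPairingHom (W := W) (κ := κ)
    (ι := closureEmb (K := K) (v.adicCompletion K)) he
  have hle := sharpFlatSelmerInfty_le_localKummerOverOfEmb W κ v (ap := ap) (g := g) (c := c) .flat
  let ν₀ : (localTowerPointsOfEmb κ (closureEmb (K := K) (v.adicCompletion K)) W →+ ℤ_[p]) →+
      (sharpFlatSelmerInfty W κ (closureEmb (K := K) (v.adicCompletion K)) ap g c .flat →+ AddCircle (1 : ℚ)) :=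
    (Φ.comp (AddSubgroup.inclusion hle)).flip
  have hν₀ : ∀ w s, ν₀ w s = Φ (AddSubgroup.inclusion hle s) w := fun w s ↦ rfl
  let ν : (localTowerPointsOfEmb κ (closureEmb (K := K) (v.adicCompletion K)) W →+ ℤ_[p]) →+ D.X :=
    D.toDualEquiv.symm.toAddMonoidHom.comp ν₀
  have hν : ∀ w, D.toDual (ν w) = ν₀ w := fun w ↦ by
    change D.toDualEquiv (D.toDualEquiv.symm (ν₀ w)) = ν₀ w
    exact AddEquiv.apply_symm_apply _ _
  have hV : ∀ (w : localTowerPointsOfEmb κ (closureEmb (K := K) (v.adicCompletion K)) W →+ ℤ_[p])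
      (s : sharpFlatSelmerInfty W κ (closureEmb (K := K) (v.adicCompletion K)) ap g c .flat)
      (φ : contOneCocycles.{0, u} (discreteTopRep κ.kerSubgroup (W.geomPrimaryTorsion p)))
      (Q : localPoints W (v.adicCompletion K)) (k : ℕ)
      (hQ : (p ^ k) • Q ∈ localTowerPointsOfEmb κ (closureEmb (K := K) (v.adicCompletion K)) W),
      oneCocycleClass (discreteTopRep κ.kerSubgroup (W.geomPrimaryTorsion p)) φ = (s : W.subgroupH1 p κ.kerSubgroup) →
      (∀ τ : localSubgroupOfEmb κ.kerSubgroup (closureEmb (K := K) (v.adicCompletion K)),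
        pointsMapOfEmb W (closureEmb (K := K) (v.adicCompletion K))
            ((φ.1 (resGalSubgroupOfEmb κ.kerSubgroup _ τ) : W.geomPrimaryTorsion p) : W.geomPoints) =
          (τ : absoluteGaloisGroup (v.adicCompletion K)) • Q - Q) →
      D.toDual (ν w) s = e ⟨(p ^ k) • Q, hQ⟩ k w := by
    intro w s φ Q k hQ hφ hτ
    rw [hν, hν₀, hΦ (AddSubgroup.inclusion hle s) φ Q k hQ hφ hτ]
  refine ⟨ν, fun w s φ Q k hQ hφ hτ a ha ↦ by rw [hV w s φ Q k hQ hφ hτ, he _ k w a ha], ?_, ?_⟩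
  · -- (K) `Ker Col♭ ⊆ ker ν`
    intro w hw
    have hmem : w ∈ colemanKer κ (closureEmb (K := K) (v.adicCompletion K)) W ap g c .flat :=
      (OddBlindNF.mem_colemanKer_flat_iff_snd_eq_zero hap J hJ w).mpr hw
    apply D.bijective.1
    rw [map_zero]
    ext s
    obtain ⟨φ, Q, k, hφ, hQ, hτ⟩ := hle s.2
    have hs := ((mem_sharpFlatSelmerInfty_iff W κ _ ap g c .flat (s : W.subgroupH1 p κ.kerSubgroup)).mp s.2).2 1
    rw [W.conjH1_one_holds p κ.kerSubgroup, AddMonoidHom.id_apply,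
      OddBlindNF.mem_sharpFlatLocalKummerOverOfEmb_iff_forall_apply_eq_zero he _ hQ hφ hτ] at hs
    rw [hV w s φ Q k hQ hφ hτ, AddMonoidHom.zero_apply]
    exact hs w hmem
  · -- (Z) `ν w` kills the fine Selmer group: a fine class is principal on `ker κ ⊓ D_v`
    intro w s hs
    have hs' := (mem_strictSelmerGroupOver_iff (H := κ.kerSubgroup) (M := W.geomPrimaryTorsion p)
      (L := fineData (W.geomPrimaryTorsion p) p) (s : W.subgroupH1 p κ.kerSubgroup)).1 hs
    have h0 : resOfLe (W.geomPrimaryTorsion p)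
        (inf_le_left : κ.kerSubgroup ⊓ decomp (K := K) v ≤ κ.kerSubgroup) (s : W.subgroupH1 p κ.kerSubgroup) = 0 := by
      have h1 : resOfLe (W.geomPrimaryTorsion p)
          (inf_le_left : κ.kerSubgroup ⊓ decomp (K := K) v ≤ κ.kerSubgroup)
          (W.conjH1 p κ.kerSubgroup 1 (s : W.subgroupH1 p κ.kerSubgroup)) = 0 := by
        by_cases hv : ((p : ℕ) : 𝓞 K) ∈ v.asIdeal
        · exact resOfLe_inf_decomp_eq_zero_of_mem_strictKer_fineLocalDatum W p v (hs'.2.2 v hv 1)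
        · exact hs'.1 v hv 1
      rwa [W.conjH1_one_holds p κ.kerSubgroup, AddMonoidHom.id_apply] at h1
    obtain ⟨φ, hφ⟩ := oneCocycleClass_surjective _ (s : W.subgroupH1 p κ.kerSubgroup)
    rw [← hφ] at h0
    obtain ⟨t, ht⟩ := exists_principal_of_resOfLe_eq_zero W p inf_le_left φ h0
    have hmem := mem_sharpFlatLocalKummerOverOfEmb_of_principal W p (resGalOfEmb_mem_decomp v) φ t
      (fun g' hg' hgD ↦ ht g' hg' (Subgroup.mem_inf.2 ⟨hg', hgD⟩))
      (localTowerPointsOfEmb κ (closureEmb (K := K) (v.adicCompletion K)) W) Set.univ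
    rw [hφ] at hmem
    obtain ⟨φ', Q, k, hφ', hQ, hτ⟩ := hle s.2
    rw [OddBlindNF.mem_sharpFlatLocalKummerOverOfEmb_iff_forall_apply_eq_zero he _ hQ hφ' hτ] at hmem
    rw [hV w s φ' Q k hQ hφ' hτ]
    exact hmem w (Set.mem_univ w)

/-- **The bridge identity `Φ(conj_δ s)(w) = Φ(s)((1+T)·w)`** for an additive `ν` with the Kummer values ((V)) into a pin `D` of key
`δ`, `γ δ = 1`, `κ γ = κ(res g) = 1`: `D.toDual (ν w) (conj_δ s) = D.toDual (ν ((1+T)·w)) s` — the Kummer datum of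
`s = conj_γ(conj_δ s) = conj_{res g}(conj_δ s)` is `(φ^g, g·Q, k)` for a datum `(φ, Q, k)` of `conj_δ s`, and `((1+T)·w)(p^k g·Q) = w(p^kQ)`.
[cite: Sprung2012, §2 p. 1486 (γ ↦ 1+T) and Def. 7.9 (p. 1503)] [cite: SerreLocalFields1979, VII §5 Prop. 3] -/
theorem toDual_flatLocalDualityHom_conjH1_of_mul_eq_one (hγ : κ.IsTopGenerator γ) {δ : absoluteGaloisGroup K}
    (hγδ : γ * δ = 1) (hg : κ.IsTopGenerator (resGalOfEmb (closureEmb (K := K) (v.adicCompletion K)) g))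
    (D : SharpFlatSelmerDualData W κ δ (closureEmb (K := K) (v.adicCompletion K)) ap g c .flat)
    (ν : (localTowerPointsOfEmb κ (closureEmb (K := K) (v.adicCompletion K)) W →+ ℤ_[p]) →+ D.X)
    (hVa : ∀ (w : localTowerPointsOfEmb κ (closureEmb (K := K) (v.adicCompletion K)) W →+ ℤ_[p])
      (s : sharpFlatSelmerInfty W κ (closureEmb (K := K) (v.adicCompletion K)) ap g c .flat)
      (φ : contOneCocycles.{0, u} (discreteTopRep κ.kerSubgroup (W.geomPrimaryTorsion p)))
      (Q : localPoints W (v.adicCompletion K)) (k : ℕ)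
      (hQ : (p ^ k) • Q ∈ localTowerPointsOfEmb κ (closureEmb (K := K) (v.adicCompletion K)) W),
      oneCocycleClass (discreteTopRep κ.kerSubgroup (W.geomPrimaryTorsion p)) φ = (s : W.subgroupH1 p κ.kerSubgroup) →
      (∀ τ : localSubgroupOfEmb κ.kerSubgroup (closureEmb (K := K) (v.adicCompletion K)),
        pointsMapOfEmb W (closureEmb (K := K) (v.adicCompletion K))
            ((φ.1 (resGalSubgroupOfEmb κ.kerSubgroup _ τ) : W.geomPrimaryTorsion p) : W.geomPoints) =
          (τ : absoluteGaloisGroup (v.adicCompletion K)) • Q - Q) →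
      ∀ a : ℤ, PadicInt.toZModPow k (w ⟨(p ^ k) • Q, hQ⟩) = (a : ZMod (p ^ k)) →
        D.toDual (ν w) s = (((a : ℚ) / (p : ℚ) ^ k : ℚ) : AddCircle (1 : ℚ)))
    (w : localTowerPointsOfEmb κ (closureEmb (K := K) (v.adicCompletion K)) W →+ ℤ_[p])
    (s : sharpFlatSelmerInfty W κ (closureEmb (K := K) (v.adicCompletion K)) ap g c .flat) :
    letI := moduleOfGenerator κ (closureEmb (K := K) (v.adicCompletion K)) W hg
    D.toDual (ν w) ⟨W.conjH1 p κ.kerSubgroup δ s, D.conj_mem s s.2⟩ =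
      D.toDual (ν ((1 + PowerSeries.X : IwasawaAlgebra p) • w)) s := by
  letI inst := moduleOfGenerator κ (closureEmb (K := K) (v.adicCompletion K)) W hg
  have hle := sharpFlatSelmerInfty_le_localKummerOverOfEmb W κ v (ap := ap) (g := g) (c := c) .flat
  obtain ⟨e, he⟩ := exists_padicPairingFamily
    (N := localTowerPointsOfEmb κ (closureEmb (K := K) (v.adicCompletion K)) W) (p := p)
  have hV : ∀ (w : localTowerPointsOfEmb κ (closureEmb (K := K) (v.adicCompletion K)) W →+ ℤ_[p])
      (s : sharpFlatSelmerInfty W κ (closureEmb (K := K) (v.adicCompletion K)) ap g c .flat)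
      (φ : contOneCocycles.{0, u} (discreteTopRep κ.kerSubgroup (W.geomPrimaryTorsion p)))
      (Q : localPoints W (v.adicCompletion K)) (k : ℕ)
      (hQ : (p ^ k) • Q ∈ localTowerPointsOfEmb κ (closureEmb (K := K) (v.adicCompletion K)) W),
      oneCocycleClass (discreteTopRep κ.kerSubgroup (W.geomPrimaryTorsion p)) φ = (s : W.subgroupH1 p κ.kerSubgroup) →
      (∀ τ : localSubgroupOfEmb κ.kerSubgroup (closureEmb (K := K) (v.adicCompletion K)),
        pointsMapOfEmb W (closureEmb (K := K) (v.adicCompletion K))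
            ((φ.1 (resGalSubgroupOfEmb κ.kerSubgroup _ τ) : W.geomPrimaryTorsion p) : W.geomPoints) =
          (τ : absoluteGaloisGroup (v.adicCompletion K)) • Q - Q) →
      D.toDual (ν w) s = e ⟨(p ^ k) • Q, hQ⟩ k w := by
    intro w s φ Q k hQ hφ hτ
    obtain ⟨a, ha⟩ := ZMod.intCast_surjective (PadicInt.toZModPow k (w ⟨(p ^ k) • Q, hQ⟩))
    rw [hVa w s φ Q k hQ hφ hτ a ha.symm, he _ k w a ha.symm]
  have hγδs : ∀ x : W.subgroupH1 p κ.kerSubgroup, W.conjH1 p κ.kerSubgroup γ (W.conjH1 p κ.kerSubgroup δ x) = x := by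
    intro x
    have h := W.conjH1_mul_holds p κ.kerSubgroup γ δ
    rw [hγδ, W.conjH1_one_holds p κ.kerSubgroup] at h
    exact (DFunLike.congr_fun h x).symm
  obtain ⟨φ, Q, k, hφ, hQ, hτ⟩ := hle (D.conj_mem s s.2)
  obtain ⟨φ', hφ', hQ', hτ'⟩ := OddBlindNF.exists_conjH1_kummerData (W := W) g hQ hτ
  rw [hφ, ← OddBlindNF.conjH1_eq_of_isTopGenerator (W := W) (p := p) hγ hg, hγδs] at hφ'
  rw [hV w ⟨W.conjH1 p κ.kerSubgroup δ s, D.conj_mem s s.2⟩ φ Q k hQ hφ hτ, hV _ s φ' (g • Q) k hQ' hφ' hτ']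
  symm
  refine OddBlindNF.padicPairingFamily_congr he ?_
  have hx : (⟨(p ^ k) • (g • Q), hQ'⟩ : localTowerPointsOfEmb κ (closureEmb (K := K) (v.adicCompletion K)) W) =
      ⟨g • ((⟨(p ^ k) • Q, hQ⟩ : localTowerPointsOfEmb κ (closureEmb (K := K) (v.adicCompletion K)) W) :
          localPoints W (v.adicCompletion K)),
        smul_mem_localTowerPointsOfEmb κ (closureEmb (K := K) (v.adicCompletion K)) W g hQ⟩ :=
    Subtype.ext (smul_comm _ _ _)
  rw [hx, smul_one_add_X_apply_smul_point W κ v hg]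

/-- **Constants act through `ℤ/p^k` on the values of `ν`**: for an additive `ν` with the Kummer values ((V)) into a pin `D` of any key,
`a ∈ ℤ_p` and `s ∈ Sel♭` with `p^{k'} s = 0`: `D.toDual (ν (C a · w)) s = (a mod p^{k'}) · D.toDual (ν w) s` (`C a · w = a · w` on functionals,
`(a·w)(x)/p^k = a·(w(x)/p^k)`, and the value is killed by `p^k` and by `p^{k'}`). [cite: Lang1990, Ch. 5 §1] [cite: Sprung2012, §2 p. 1486] -/
theorem toDual_flatLocalDualityHom_C_smul (hg : κ.IsTopGenerator (resGalOfEmb (closureEmb (K := K) (v.adicCompletion K)) g))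
    {γD : absoluteGaloisGroup K} (D : SharpFlatSelmerDualData W κ γD (closureEmb (K := K) (v.adicCompletion K)) ap g c .flat)
    (ν : (localTowerPointsOfEmb κ (closureEmb (K := K) (v.adicCompletion K)) W →+ ℤ_[p]) →+ D.X)
    (hVa : ∀ (w : localTowerPointsOfEmb κ (closureEmb (K := K) (v.adicCompletion K)) W →+ ℤ_[p])
      (s : sharpFlatSelmerInfty W κ (closureEmb (K := K) (v.adicCompletion K)) ap g c .flat)
      (φ : contOneCocycles.{0, u} (discreteTopRep κ.kerSubgroup (W.geomPrimaryTorsion p)))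
      (Q : localPoints W (v.adicCompletion K)) (k : ℕ)
      (hQ : (p ^ k) • Q ∈ localTowerPointsOfEmb κ (closureEmb (K := K) (v.adicCompletion K)) W),
      oneCocycleClass (discreteTopRep κ.kerSubgroup (W.geomPrimaryTorsion p)) φ = (s : W.subgroupH1 p κ.kerSubgroup) →
      (∀ τ : localSubgroupOfEmb κ.kerSubgroup (closureEmb (K := K) (v.adicCompletion K)),
        pointsMapOfEmb W (closureEmb (K := K) (v.adicCompletion K))
            ((φ.1 (resGalSubgroupOfEmb κ.kerSubgroup _ τ) : W.geomPrimaryTorsion p) : W.geomPoints) =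
          (τ : absoluteGaloisGroup (v.adicCompletion K)) • Q - Q) →
      ∀ a : ℤ, PadicInt.toZModPow k (w ⟨(p ^ k) • Q, hQ⟩) = (a : ZMod (p ^ k)) →
        D.toDual (ν w) s = (((a : ℚ) / (p : ℚ) ^ k : ℚ) : AddCircle (1 : ℚ)))
    (a : ℤ_[p]) (w : localTowerPointsOfEmb κ (closureEmb (K := K) (v.adicCompletion K)) W →+ ℤ_[p])
    (s : sharpFlatSelmerInfty W κ (closureEmb (K := K) (v.adicCompletion K)) ap g c .flat) {k' : ℕ} (hk' : p ^ k' • s = 0) :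
    letI := moduleOfGenerator κ (closureEmb (K := K) (v.adicCompletion K)) W hg
    D.toDual (ν ((PowerSeries.C a : IwasawaAlgebra p) • w)) s = zpT p k' a (D.toDual (ν w) s) := by
  letI inst := moduleOfGenerator κ (closureEmb (K := K) (v.adicCompletion K)) W hg
  have hle := sharpFlatSelmerInfty_le_localKummerOverOfEmb W κ v (ap := ap) (g := g) (c := c) .flat
  obtain ⟨e, he⟩ := exists_padicPairingFamily
    (N := localTowerPointsOfEmb κ (closureEmb (K := K) (v.adicCompletion K)) W) (p := p)
  have hV : ∀ (w : localTowerPointsOfEmb κ (closureEmb (K := K) (v.adicCompletion K)) W →+ ℤ_[p])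
      (s : sharpFlatSelmerInfty W κ (closureEmb (K := K) (v.adicCompletion K)) ap g c .flat)
      (φ : contOneCocycles.{0, u} (discreteTopRep κ.kerSubgroup (W.geomPrimaryTorsion p)))
      (Q : localPoints W (v.adicCompletion K)) (k : ℕ)
      (hQ : (p ^ k) • Q ∈ localTowerPointsOfEmb κ (closureEmb (K := K) (v.adicCompletion K)) W),
      oneCocycleClass (discreteTopRep κ.kerSubgroup (W.geomPrimaryTorsion p)) φ = (s : W.subgroupH1 p κ.kerSubgroup) →
      (∀ τ : localSubgroupOfEmb κ.kerSubgroup (closureEmb (K := K) (v.adicCompletion K)),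
        pointsMapOfEmb W (closureEmb (K := K) (v.adicCompletion K))
            ((φ.1 (resGalSubgroupOfEmb κ.kerSubgroup _ τ) : W.geomPrimaryTorsion p) : W.geomPoints) =
          (τ : absoluteGaloisGroup (v.adicCompletion K)) • Q - Q) →
      D.toDual (ν w) s = e ⟨(p ^ k) • Q, hQ⟩ k w := by
    intro w s φ Q k hQ hφ hτ
    obtain ⟨a, ha⟩ := ZMod.intCast_surjective (PadicInt.toZModPow k (w ⟨(p ^ k) • Q, hQ⟩))
    rw [hVa w s φ Q k hQ hφ hτ a ha.symm, he _ k w a ha.symm]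
  obtain ⟨φ, Q, k, hφ, hQ, hτ⟩ := hle s.2
  have hy' : p ^ k' • D.toDual (ν w) s = 0 := by rw [← map_nsmul, hk', map_zero]
  rw [hV w s φ Q k hQ hφ hτ] at hy'
  have hy : p ^ k • e ⟨(p ^ k) • Q, hQ⟩ k w = 0 := by
    rw [← AddMonoidHom.nsmul_apply, padicPairingFamily_pow_nsmul he, AddMonoidHom.zero_apply]
  rw [hV _ s φ Q k hQ hφ hτ, hV w s φ Q k hQ hφ hτ, moduleOfGenerator_smul_eq, lambdaSMul_C,
    padicPairingFamily_smul_right he]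
  rcases le_total k k' with h | h
  · exact (zpT_of_le h hy a).symm
  · exact zpT_of_le h hy' a
set_option maxHeartbeats 400000 in -- buildfix (bf3-g31): 160k/180k FAIL, 200k PASS at accept time; line-neutral budget line
/-- **Linearity criterion: an additive map with the Kummer values is `Λ`-LINEAR into a contragredient pin.**  For `κ γ = κ(res g) = 1`,
`γ δ = 1`, a ♭ dual datum `D` OF KEY `δ` and ANY additive `ν : (E(K_∞·K_v) →+ ℤ_p) →+ D.X` with the Kummer values ((V)):
`ν (f • w) = f • ν w` for all `f ∈ Λ` — the bridge identity iterated along `ψ = conj_δ − 1` (`Φ(ψ^i s)(w) = Φ(s)(T^i·w)`), constants through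
`ℤ/p^k`, the finite-sum action `Σ_{i<N} c_i x(ψ^i s)` of the pin through `toDual` (`SharpFlatSelmerDualData.toDual_smul`, `ψ^N s = 0`), and
the tail `f − Σ_{i<N} c_i T^i = T^N·q` contributing `Φ(ψ^N s)(q·w) = 0`. [cite: Sprung2012, §2 p. 1486 and Def. 7.11 (p. 1503)]
[cite: GreenbergLNM1716, §1 p. 60] [cite: Greenberg1989, pp. 101–102] [cite: Washington1997, §13.2] -/
theorem flatLocalDualityHom_map_smul_of_mul_eq_one (hγ : κ.IsTopGenerator γ) {δ : absoluteGaloisGroup K} (hγδ : γ * δ = 1)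
    (hg : κ.IsTopGenerator (resGalOfEmb (closureEmb (K := K) (v.adicCompletion K)) g))
    (D : SharpFlatSelmerDualData W κ δ (closureEmb (K := K) (v.adicCompletion K)) ap g c .flat)
    (ν : (localTowerPointsOfEmb κ (closureEmb (K := K) (v.adicCompletion K)) W →+ ℤ_[p]) →+ D.X)
    (hVa : ∀ (w : localTowerPointsOfEmb κ (closureEmb (K := K) (v.adicCompletion K)) W →+ ℤ_[p])
      (s : sharpFlatSelmerInfty W κ (closureEmb (K := K) (v.adicCompletion K)) ap g c .flat)
      (φ : contOneCocycles.{0, u} (discreteTopRep κ.kerSubgroup (W.geomPrimaryTorsion p)))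
      (Q : localPoints W (v.adicCompletion K)) (k : ℕ)
      (hQ : (p ^ k) • Q ∈ localTowerPointsOfEmb κ (closureEmb (K := K) (v.adicCompletion K)) W),
      oneCocycleClass (discreteTopRep κ.kerSubgroup (W.geomPrimaryTorsion p)) φ = (s : W.subgroupH1 p κ.kerSubgroup) →
      (∀ τ : localSubgroupOfEmb κ.kerSubgroup (closureEmb (K := K) (v.adicCompletion K)),
        pointsMapOfEmb W (closureEmb (K := K) (v.adicCompletion K))
            ((φ.1 (resGalSubgroupOfEmb κ.kerSubgroup _ τ) : W.geomPrimaryTorsion p) : W.geomPoints) =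
          (τ : absoluteGaloisGroup (v.adicCompletion K)) • Q - Q) →
      ∀ a : ℤ, PadicInt.toZModPow k (w ⟨(p ^ k) • Q, hQ⟩) = (a : ZMod (p ^ k)) →
        D.toDual (ν w) s = (((a : ℚ) / (p : ℚ) ^ k : ℚ) : AddCircle (1 : ℚ)))
    (f : IwasawaAlgebra p) (w : localTowerPointsOfEmb κ (closureEmb (K := K) (v.adicCompletion K)) W →+ ℤ_[p]) :
    letI := moduleOfGenerator κ (closureEmb (K := K) (v.adicCompletion K)) W hg
    ν (f • w) = f • ν w := by
  letI inst := moduleOfGenerator κ (closureEmb (K := K) (v.adicCompletion K)) W hg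
  have hT0 := toDual_flatLocalDualityHom_conjH1_of_mul_eq_one W κ v hγ hγδ hg D ν hVa
  have hC := toDual_flatLocalDualityHom_C_smul W κ v hg D ν hVa
  set hD := isLocNil_conjSharpFlatSelmerInfty_sub_one' W κ (closureEmb (K := K) (v.adicCompletion K)) ap g c .flat δ
  set ψ : AddMonoid.End (sharpFlatSelmerInfty W κ (closureEmb (K := K) (v.adicCompletion K)) ap g c .flat) :=
    conjSharpFlatSelmerInfty W κ (closureEmb (K := K) (v.adicCompletion K)) ap g c .flat δ - 1 with hψ
  have hψeval : ∀ (y : D.X) (s : sharpFlatSelmerInfty W κ (closureEmb (K := K) (v.adicCompletion K)) ap g c .flat),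
      D.toDual y (ψ s) = D.toDual y ⟨W.conjH1 p κ.kerSubgroup δ s, D.conj_mem s s.2⟩ - D.toDual y s := fun y s ↦ by
    rw [hψ, End_sub_apply, AddMonoid.End.one_apply, map_sub]
    rfl
  -- (T1) `Φ(ψ s)(w) = Φ(s)(T • w)`
  have hT1 : ∀ (w : localTowerPointsOfEmb κ (closureEmb (K := K) (v.adicCompletion K)) W →+ ℤ_[p])
      (s : sharpFlatSelmerInfty W κ (closureEmb (K := K) (v.adicCompletion K)) ap g c .flat),
      D.toDual (ν w) (ψ s) = D.toDual (ν ((PowerSeries.X : IwasawaAlgebra p) • w)) s := by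
    intro w s
    have hXw : (PowerSeries.X : IwasawaAlgebra p) • w = (1 + PowerSeries.X : IwasawaAlgebra p) • w - w := by
      rw [add_smul, one_smul, add_sub_cancel_left]
    rw [hXw, map_sub, map_sub, AddMonoidHom.sub_apply, hψeval, hT0]
  -- (T2) `Φ(ψ^i s)(w) = Φ(s)(T^i • w)`
  have hT2 : ∀ (i : ℕ) (w : localTowerPointsOfEmb κ (closureEmb (K := K) (v.adicCompletion K)) W →+ ℤ_[p])
      (s : sharpFlatSelmerInfty W κ (closureEmb (K := K) (v.adicCompletion K)) ap g c .flat),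
      D.toDual (ν w) ((ψ ^ i) s) = D.toDual (ν ((PowerSeries.X : IwasawaAlgebra p) ^ i • w)) s := by
    intro i
    induction i with
    | zero => intro w s; rw [pow_zero, AddMonoid.End.one_apply, pow_zero, one_smul]
    | succ i ih =>
      intro w s
      rw [pow_succ, AddMonoid.End.coe_mul, Function.comp_apply, ih w (ψ s), hT1, ← mul_smul, ← pow_succ']
  apply D.bijective.1
  refine AddMonoidHom.ext fun s ↦ ?_
  obtain ⟨N, hN⟩ := hD.nil s
  obtain ⟨k', hk'⟩ := hD.torsion s
  rw [D.toDual_smul, hD.smulFun_apply f _ hN hk', evalT_def]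
  have hterm : ∀ i ∈ Finset.range N, zpT p k' (PowerSeries.coeff i f) (D.toDual (ν w) ((ψ ^ i) s)) =
      D.toDual (ν ((PowerSeries.C (PowerSeries.coeff i f) * PowerSeries.X ^ i : IwasawaAlgebra p) • w)) s := by
    intro i _
    rw [hT2, ← hC _ _ s hk', mul_smul]
  rw [Finset.sum_congr rfl hterm]
  let L : (localTowerPointsOfEmb κ (closureEmb (K := K) (v.adicCompletion K)) W →+ ℤ_[p]) →+ AddCircle (1 : ℚ) :=
    (D.toDual.flip s).comp ν
  have hL : ∀ w', D.toDual (ν w') s = L w' := fun _ ↦ rfl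
  simp only [hL]
  rw [← map_sum, ← Finset.sum_smul, ← sub_eq_zero, ← map_sub, ← sub_smul]
  -- the tail `f − Σ_{i<N} c_i T^i = T^N · q` is killed by `ψ^N s = 0`
  have hdvd : (PowerSeries.X : IwasawaAlgebra p) ^ N ∣
      f - ∑ i ∈ Finset.range N, (PowerSeries.C (PowerSeries.coeff i f) * PowerSeries.X ^ i : IwasawaAlgebra p) := by
    rw [PowerSeries.X_pow_dvd_iff]
    intro m hm
    rw [map_sub, map_sum]
    simp_rw [PowerSeries.coeff_C_mul_X_pow]
    rw [Finset.sum_ite_eq_of_mem _ _ _ (Finset.mem_range.mpr hm), sub_self]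
  obtain ⟨q, hq⟩ := hdvd
  rw [hq, mul_smul, ← hL, ← hT2, hN, map_zero]

/-- ★ **The ♭ local duality map is `Λ`-LINEAR into a contragredient pin.**  For `κ γ = κ(res g) = 1` (`1 + T ↦ Θ_g` on functionals),
`γ δ = 1`, `p ∣ a_p`, any ♭ Coleman family `J` (`Col(z) = (Js z, (J z).2)`) and any ♭ dual datum `D` OF KEY `δ`: there is a `Λ`-LINEAR
`ν : (E(K_∞·K_v) →+ ℤ_p) →ₗ[Λ] D.X` with (V) `D.toDual (ν w) s = w(p^kQ)/p^k mod ℤ` on Kummer data, (K) `(J w).2 = 0 → ν w = 0`, (Z) `ν w`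
kills `Sel₀(K_∞, E[p^∞])` (`exists_flatLocalDualityHom_of_key` + `flatLocalDualityHom_map_smul_of_mul_eq_one`).
[cite: Kobayashi2003, (7.17)–(7.21) (p. 12)] [cite: Sprung2012, §2 p. 1486, Def. 7.9, Def. 7.11 (p. 1503), Prop. 7.19 (p. 1505)]
[cite: GreenbergLNM1716, §1 p. 60] [cite: Greenberg1989, pp. 101–102] -/
theorem exists_flatLocalDualityLinearMap_of_mul_eq_one (hγ : κ.IsTopGenerator γ) {δ : absoluteGaloisGroup K} (hγδ : γ * δ = 1)
    (hg : κ.IsTopGenerator (resGalOfEmb (closureEmb (K := K) (v.adicCompletion K)) g)) (hap : (p : ℤ) ∣ ap)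
    {M : Type*} (J : (localTowerPointsOfEmb κ (closureEmb (K := K) (v.adicCompletion K)) W →+ ℤ_[p]) → M × IwasawaAlgebra p)
    {Js : (localTowerPointsOfEmb κ (closureEmb (K := K) (v.adicCompletion K)) W →+ ℤ_[p]) → IwasawaAlgebra p}
    (hJ : ∀ z, IsColemanPair κ (closureEmb (K := K) (v.adicCompletion K)) W ap g c z (Js z) (J z).2)
    (D : SharpFlatSelmerDualData W κ δ (closureEmb (K := K) (v.adicCompletion K)) ap g c .flat) :
    letI := moduleOfGenerator κ (closureEmb (K := K) (v.adicCompletion K)) W hg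
    ∃ ν : (localTowerPointsOfEmb κ (closureEmb (K := K) (v.adicCompletion K)) W →+ ℤ_[p]) →ₗ[IwasawaAlgebra p] D.X,
      (∀ (w : localTowerPointsOfEmb κ (closureEmb (K := K) (v.adicCompletion K)) W →+ ℤ_[p])
          (s : sharpFlatSelmerInfty W κ (closureEmb (K := K) (v.adicCompletion K)) ap g c .flat)
          (φ : contOneCocycles.{0, u} (discreteTopRep κ.kerSubgroup (W.geomPrimaryTorsion p)))
          (Q : localPoints W (v.adicCompletion K)) (k : ℕ)
          (hQ : (p ^ k) • Q ∈ localTowerPointsOfEmb κ (closureEmb (K := K) (v.adicCompletion K)) W),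
          oneCocycleClass (discreteTopRep κ.kerSubgroup (W.geomPrimaryTorsion p)) φ = (s : W.subgroupH1 p κ.kerSubgroup) →
          (∀ τ : localSubgroupOfEmb κ.kerSubgroup (closureEmb (K := K) (v.adicCompletion K)),
            pointsMapOfEmb W (closureEmb (K := K) (v.adicCompletion K))
                ((φ.1 (resGalSubgroupOfEmb κ.kerSubgroup _ τ) : W.geomPrimaryTorsion p) : W.geomPoints) =
              (τ : absoluteGaloisGroup (v.adicCompletion K)) • Q - Q) →
          ∀ a : ℤ, PadicInt.toZModPow k (w ⟨(p ^ k) • Q, hQ⟩) = (a : ZMod (p ^ k)) →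
            D.toDual (ν w) s = (((a : ℚ) / (p : ℚ) ^ k : ℚ) : AddCircle (1 : ℚ))) ∧
      (∀ w, (J w).2 = 0 → ν w = 0) ∧
      (∀ (w) (s : sharpFlatSelmerInfty W κ (closureEmb (K := K) (v.adicCompletion K)) ap g c .flat),
          (s : W.subgroupH1 p κ.kerSubgroup) ∈ W.fineSelmerInfty κ → D.toDual (ν w) s = 0) := by
  letI inst := moduleOfGenerator κ (closureEmb (K := K) (v.adicCompletion K)) W hg
  obtain ⟨ν, hV, hK, hZ⟩ := exists_flatLocalDualityHom_of_key W κ v hap J hJ D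
  have hlin := flatLocalDualityHom_map_smul_of_mul_eq_one W κ v hγ hγδ hg D ν hV
  exact ⟨{ toFun := ν, map_add' := fun a b ↦ map_add ν a b, map_smul' := fun f w ↦ hlin f w }, hV, hK, hZ⟩

end SSFlatPackage

end Summit.BirchSwinnertonDyer.BirchSwinnertonDyer.Theorems

end
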